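import Mathlib
import HarnessLib
import Summits.ValiantsHypothesis.ValiantsHypothesis.Theses.MonotoneRestoration
import Literature.Computability.AlgebraicComplexity.ArithCircuit
import Literature.Computability.AlgebraicComplexity.ArithCircuitProofs
import Literature.Computability.AlgebraicComplexity.MonotoneStructure
import Literature.Computability.AlgebraicComplexity.PermanentIrreducible
import Literature.ModelTheory.FiniteModelTheory.CkEquiv
import Summits.ValiantsHypothesis.ValiantsHypothesis.Theorems.MonotoneRestorationMonotoneRestorationQPCosetCount
import Summits.ValiantsHypothesis.ValiantsHypothesis.Theorems.MonotoneRestorationMonotoneRestorationQPSymmetricLB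
import Summits.ValiantsHypothesis.ValiantsHypothesis.Theorems.MonotoneRestorationMonotoneRestorationQPSupportSymmetrisation
import Summits.ValiantsHypothesis.ValiantsHypothesis.Theorems.MonotoneRestorationMonotoneRestorationQPSparseRegime
import Summits.ValiantsHypothesis.ValiantsHypothesis.Theorems.MonotoneRestorationMonotoneRestorationQPBeta
import Literature.Computability.AlgebraicComplexity.SymmetricArithCircuit
import Literature.Computability.AlgebraicComplexity.DawarWilsenach2025Proofs
import Literature.GroupTheory.PermutationGroups.SmallIndexSubgroups
import Summits.ValiantsHypothesis.ValiantsHypothesis.Theorems.MonotoneRestorationQP.Negative.LoadBearing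
import Summits.ValiantsHypothesis.ValiantsHypothesis.Theorems.MonotoneRestorationMonotoneRestorationQPPermSupportCount

/-! # TTRL-lite variant V21713 of `MonotoneRestorationQP` / `stub_altFixing_orbit_dichotomy` (stmt-ValiantsHypothesis-15886)

Machine-generated helper (proved); move `lemma_proposal`, op `llm`: [rename_matching] the diagonal renaming of a matching polynomial x_ab+x_ba+x_cd+x_dc is the matching polynomial of the image pairs — CHECKED here: `intro …; simp [map_add, MvPolynomial.rename_X]` clos.
See docs/architecture/ttrl-lite.md. -/

namespace Summit.ValiantsHypothesis.ValiantsHypothesis.Theorems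

open Summit.ValiantsHypothesis.ValiantsHypothesis.Theses.MonotoneRestoration
open Literature.Computability.AlgebraicComplexity

/-- TTRL-lite variant V21713 (lemma_proposal `llm`) of `stub_altFixing_orbit_dichotomy` (stmt-ValiantsHypothesis-15886); machine-found, kernel-checked. -/
theorem stub_altFixing_orbit_dichotomy_var21713 :
    ∀ (n : ℕ) (K : Type) [CommSemiring K] (ρ : Equiv.Perm (Fin n)) (a b c d : Fin n), MvPolynomial.rename (fun p : Fin n × Fin n => (ρ p.1, ρ p.2)) ((MvPolynomial.X (a, b) + MvPolynomial.X (b, a) + MvPolynomial.X (c, d) + MvPolynomial.X (d, c) : MvPolynomial (Fin n × Fin n) K)) = MvPolynomial.X (ρ a, ρ b) + MvPolynomial.X (ρ b, ρ a) + MvPolynomial.X (ρ c, ρ d) + MvPolynomial.X (ρ d, ρ c) := by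
  intros
  norm_num

end Summit.ValiantsHypothesis.ValiantsHypothesis.Theorems
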